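import Literature.NumberTheory.Rogawski1990.ArchExplicitTransferFactorCurveDeriv           -- ★ p839618 (this seat): per-place differentiability along the singular curve
import Literature.NumberTheory.Rogawski1990.ArchExplicitTransferFactorCentral              -- ★ `archHeckeValue_mul`
import Literature.Analysis.SpecialFunctions.ContinuousMultiplicativeCharacterDifferentiable  -- ★ §A (B-p17 (g23)): `differentiableAt_of_map_mul_complex`
import HarnessLib

/-!
# `Δ″_∞` IS DIFFERENTIABLE IN `ψ` AT THE SINGULAR POINT — unconditionally: the archimedean Hecke value `μ_∞` factorises over the complex places and each
# factor is a smooth character of `ℂˣ` (★ §A), so the binder `hμ` of ★ `differentiableAt_archExplicitDelta_archSingularCurve_of` is discharged (Rogawski (1990) §8.2 (8.2.1))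

Topic `NumberTheory/Rogawski1990`; namespace `Literature.NumberTheory.Rogawski1990`.  THEOREMS ONLY (no definition, no named fact, no instance, no notation,
no `sorry`; net debt 0).  Cell `pub/hodgecm-mathlib`, F0∕P3a, topic T6 (#88 side; brick §B «μ_∞-SMOOTH DISCHARGE» recut to the CURVE COMPLEMENT, LEAD F0P3a-plan (g9) T8-4 ∕ T8-10 (B); §A = ★ B-p17 (g23)
`Analysis/SpecialFunctions/ContinuousMultiplicativeCharacterDifferentiable` (`differentiableAt_of_map_mul_complex`), consumed BY NAME; the generic mixed-space head
`differentiableAt_archHeckeValue` is B-p17's ★ `ArchHeckeValueDifferentiable` (first in time, T8-10 (A)) and is NOT restated here — this file goes PLACE BY PLACE,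
which keeps every `DifferentiableAt` scalar-valued (`ℝ → ℂ`).)  Mathlib-only footing; count-neutral.

THE MATHEMATICS.  `L` is CM, so `L ⊗ ℝ = Π_{w complex} ℂ` (no real place) and `(L ⊗ ℝ)ˣ = Π_w ℂˣ`.  For the single-place insertion
`ι_w(z) = (1, …, z, …, 1)` one has `x = Π_w ι_w(x_w)`, so multiplicativity of `μ_∞ = archHeckeValue μ` (★ `archHeckeValue_mul`) gives the PLACE FACTORISATION
`μ_∞(x) = Π_w F_w(x_w)`, `F_w(z) := μ_∞(ι_w z)` — each `F_w` a continuous multiplicative function on `ℂ ∖ {0}` (★ F3A `continuousAt_archHeckeValue`), i.e. a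
continuous character of `ℂˣ`; print p. 123: `μ_w⁻¹(z) = z|z|⁻¹(z∕z̄)^t`.  Continuous multiplicative non-vanishing functions on `ℂ ∖ {0}` are real-differentiable
(★ §A `differentiableAt_of_map_mul_complex`), so — composing with the per-place differentiability of `τ`'s argument along ★ B-p12's lifted singular curve
(★ `differentiableAt_evalC_archTauArg_archSingularCurveH`) — the binder `hμ` of ★ `differentiableAt_archExplicitDelta_archSingularCurve_of` is discharged:
`ψ ↦ Δ″_∞(γ_H(ψ), γ(ψ))` is differentiable at `ψ = 0` OUTRIGHT — the transfer-factor half of print's `∂∕∂ψ (τ(γ)D_G(γ)Φ^κ(γ,f))` ((8.2.1) p. 123).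

* §1 **`archHeckeValue_eq_prod_single`** (PLACE FACTORISATION `μ_∞(x) = Π_w μ_∞(ι_w x_w)`), `archHeckeValue_single_mul`, `archHeckeValue_single_ne_zero`,
  `continuousAt_archHeckeValue_single`, **`differentiableAt_archHeckeValue_single`** (each place factor `F_w` is differentiable off `0`, ★ §A).
* §2 **`differentiableAt_archHeckeValue_archTauArg_archSingularCurve`** (`hμ` DISCHARGED), **`differentiableAt_archTau_archSingularCurve`**,
  **`differentiableAt_archExplicitDelta_archSingularCurve`** — all UNCONDITIONAL.

HONEST LABEL: HC_CM is proved only modulo the printed citations (named inputs remaining 2) until rung 0 closes; this file proves none of them.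

## References
* [Rogawski1990] J. D. Rogawski, *Automorphic Representations of Unitary Groups in Three Variables*, Ann. of Math. Stud. 123 (1990): §8.2 (8.2.1) p. 123 (`μ⁻¹(z) =
  z|z|⁻¹(z∕z̄)^t`; differentiation in `ψ`), §4.9 p. 55.
* [TateThesis1967] J. Tate, *Fourier analysis in number fields and Hecke's zeta-functions*, §2.3 (quasi-characters of `ℂˣ`).
-/

set_option autoImplicit false

noncomputable section

open NumberField NumberField.InfinitePlace Matrix Polynomial Filter Topology Complex
open scoped MatrixGroups

namespace Literature.NumberTheory.Rogawski1990

open Literature.NumberTheory.Automorphic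
open Literature.NumberTheory.GaloisRepresentations

/-! ## §1 Place factorisation of `μ_∞` (unconditional) -/

section Single

variable (L : Type) [Field L] [NumberField L] [IsCMField L]

omit [NumberField L] [IsCMField L] in
/-- A totally complex field has no real place (CM fields are totally complex). [folklore] -/
private theorem isEmpty_isReal_of_isCMField [IsTotallyComplex L] : IsEmpty {w : InfinitePlace L // IsReal w} :=
  ⟨fun w => (not_isReal_iff_isComplex.2 (IsTotallyComplex.isComplex w.1)) w.2⟩

open scoped Classical in
omit [NumberField L] [IsCMField L] in
/-- **The single-place insertion `ι_w(z) = (1; 1, …, z, …, 1) ∈ L ⊗ ℝ` is a unit iff `z ≠ 0`.** [folklore] -/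
private theorem isUnit_single_iff (w : {w : InfinitePlace L // IsComplex w}) (z : ℂ) :
    IsUnit (((fun _ => 1, Pi.mulSingle w z) : mixedEmbedding.mixedSpace L)) ↔ z ≠ 0 := by
  rw [Prod.isUnit_iff, Pi.isUnit_iff, Pi.isUnit_iff]
  constructor
  · rintro ⟨-, h⟩
    have hw := h w
    dsimp only at hw
    rw [Pi.mulSingle_eq_same, isUnit_iff_ne_zero] at hw
    exact hw
  · intro hz
    refine ⟨fun v => isUnit_one, fun w' => ?_⟩
    dsimp only
    by_cases h : w' = w
    · subst h
      rw [Pi.mulSingle_eq_same, isUnit_iff_ne_zero]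
      exact hz
    · rw [Pi.mulSingle_eq_of_ne h]; exact isUnit_one

open scoped Classical in
/-- `Π_w ι_w(x_w) = x` in `L ⊗ ℝ` (CM: no real coordinate). [folklore] -/
private theorem prod_single_eq (x : mixedEmbedding.mixedSpace L) :
    (∏ w : {w : InfinitePlace L // IsComplex w}, ((fun _ => 1, Pi.mulSingle w (x.2 w)) : mixedEmbedding.mixedSpace L)) = x := by
  haveI := isEmpty_isReal_of_isCMField L
  refine Prod.ext (Subsingleton.elim _ _) ?_
  rw [Prod.snd_prod, Finset.univ_prod_mulSingle]

open scoped Classical in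
/-- **PLACE FACTORISATION `μ_∞(x) = Π_w μ_∞(ι_w x_w)`** for a unit `x ∈ L ⊗ ℝ` (★ `archHeckeValue_mul`; `x = Π_w ι_w(x_w)`). [cite: TateThesis1967, §2.3] [cite: Rogawski1990, §8.2 p. 123] -/
theorem archHeckeValue_eq_prod_single (μ : HeckeCharacter L) {x : mixedEmbedding.mixedSpace L} (hx : IsUnit x) :
    archHeckeValue L μ x =
      ∏ w : {w : InfinitePlace L // IsComplex w}, archHeckeValue L μ (((fun _ => 1, Pi.mulSingle w (x.2 w)) : mixedEmbedding.mixedSpace L)) := by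
  classical
  have hxw : ∀ w : {w : InfinitePlace L // IsComplex w}, x.2 w ≠ 0 := fun w =>
    ((Pi.isUnit_iff.1 (Prod.isUnit_iff.1 hx).2) w).ne_zero
  -- multiplicativity over any finset of places
  have key : ∀ s : Finset {w : InfinitePlace L // IsComplex w},
      IsUnit (∏ w ∈ s, ((fun _ => 1, Pi.mulSingle w (x.2 w)) : mixedEmbedding.mixedSpace L)) ∧
        archHeckeValue L μ (∏ w ∈ s, ((fun _ => 1, Pi.mulSingle w (x.2 w)) : mixedEmbedding.mixedSpace L)) =
          ∏ w ∈ s, archHeckeValue L μ (((fun _ => 1, Pi.mulSingle w (x.2 w)) : mixedEmbedding.mixedSpace L)) := by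
    intro s
    induction s using Finset.induction_on with
    | empty =>
      refine ⟨by simp, ?_⟩
      rw [Finset.prod_empty, Finset.prod_empty]
      -- `μ_∞(1) = 1`
      have h1 := archHeckeValue_mul L μ (x := (1 : mixedEmbedding.mixedSpace L)) (y := 1) isUnit_one isUnit_one
      rw [one_mul] at h1
      have hne : archHeckeValue L μ (1 : mixedEmbedding.mixedSpace L) ≠ 0 := archHeckeValue_ne_zero_of_isUnit L μ isUnit_one
      -- `a = a * a`, `a ≠ 0` ⇒ `a = 1`
      have := mul_left_cancel₀ hne (h1.symm.trans (mul_one _).symm)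
      exact this
    | insert w s hw ih =>
      have hu : IsUnit (((fun _ => 1, Pi.mulSingle w (x.2 w)) : mixedEmbedding.mixedSpace L)) := (isUnit_single_iff L w _).2 (hxw w)
      refine ⟨?_, ?_⟩
      · rw [Finset.prod_insert hw]; exact hu.mul ih.1
      · rw [Finset.prod_insert hw, Finset.prod_insert hw, archHeckeValue_mul L μ hu ih.1, ih.2]
  have h := (key Finset.univ).2
  rwa [prod_single_eq L x] at h

omit [IsCMField L] in
open scoped Classical in
/-- `F_w(z z′) = F_w(z) F_w(z′)` for `F_w(z) = μ_∞(ι_w z)`, `z, z′ ≠ 0`. [cite: TateThesis1967, §2.3] -/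
theorem archHeckeValue_single_mul (μ : HeckeCharacter L) (w : {w : InfinitePlace L // IsComplex w}) {z z' : ℂ} (hz : z ≠ 0) (hz' : z' ≠ 0) :
    archHeckeValue L μ (((fun _ => 1, Pi.mulSingle w (z * z')) : mixedEmbedding.mixedSpace L)) =
      archHeckeValue L μ (((fun _ => 1, Pi.mulSingle w z) : mixedEmbedding.mixedSpace L)) *
        archHeckeValue L μ (((fun _ => 1, Pi.mulSingle w z') : mixedEmbedding.mixedSpace L)) := by
  have hprod : (((fun _ => 1, Pi.mulSingle w z) : mixedEmbedding.mixedSpace L) * ((fun _ => 1, Pi.mulSingle w z') : mixedEmbedding.mixedSpace L)) =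
      ((fun _ => 1, Pi.mulSingle w (z * z')) : mixedEmbedding.mixedSpace L) :=
    Prod.ext (funext fun _ => mul_one _)
      (by
        change (Pi.mulSingle w z : {w : InfinitePlace L // IsComplex w} → ℂ) * Pi.mulSingle w z' = Pi.mulSingle w (z * z')
        exact (Pi.mulSingle_mul (f := fun _ : {w : InfinitePlace L // IsComplex w} => ℂ) w z z').symm)
  rw [← hprod, archHeckeValue_mul L μ ((isUnit_single_iff L w z).2 hz) ((isUnit_single_iff L w z').2 hz')]

omit [IsCMField L] in
open scoped Classical in
/-- `F_w(z) ≠ 0` for `z ≠ 0`. [cite: TateThesis1967, §2.3] -/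
theorem archHeckeValue_single_ne_zero (μ : HeckeCharacter L) (w : {w : InfinitePlace L // IsComplex w}) {z : ℂ} (hz : z ≠ 0) :
    archHeckeValue L μ (((fun _ => 1, Pi.mulSingle w z) : mixedEmbedding.mixedSpace L)) ≠ 0 :=
  archHeckeValue_ne_zero_of_isUnit L μ ((isUnit_single_iff L w z).2 hz)

omit [IsCMField L] in
open scoped Classical in
/-- `F_w` is continuous at every `z ≠ 0` (★ `continuousAt_archHeckeValue`). [cite: TateThesis1967, §2.3] -/
theorem continuousAt_archHeckeValue_single (μ : HeckeCharacter L) (w : {w : InfinitePlace L // IsComplex w}) {z : ℂ} (hz : z ≠ 0) :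
    ContinuousAt (fun z : ℂ => archHeckeValue L μ (((fun _ => 1, Pi.mulSingle w z) : mixedEmbedding.mixedSpace L))) z := by
  have hι : Continuous fun z : ℂ => (((fun _ => 1, Pi.mulSingle w z) : mixedEmbedding.mixedSpace L)) :=
    continuous_const.prodMk (_root_.continuous_mulSingle (A := fun _ : {w : InfinitePlace L // IsComplex w} => ℂ) w)
  exact ContinuousAt.comp (g := archHeckeValue L μ) (f := fun z : ℂ => (((fun _ => 1, Pi.mulSingle w z) : mixedEmbedding.mixedSpace L)))
    (continuousAt_archHeckeValue L μ ((isUnit_single_iff L w z).2 hz)) hι.continuousAt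

omit [IsCMField L] in
open scoped Classical in
/-- **Each place factor `F_w(z) = μ_∞(ι_w z)` is real-differentiable at every `z₀ ≠ 0`** — a continuous multiplicative non-vanishing function on `ℂ ∖ {0}`
(★ §A `differentiableAt_of_map_mul_complex`; print: `μ_w(z) = (z∕|z|)^{t_w}|z|^{s_w}`). [cite: Rogawski1990, §8.2 p. 123] [cite: TateThesis1967, §2.3] -/
theorem differentiableAt_archHeckeValue_single (μ : HeckeCharacter L) (w : {w : InfinitePlace L // IsComplex w}) {z₀ : ℂ} (hz₀ : z₀ ≠ 0) :
    DifferentiableAt ℝ (fun z : ℂ => archHeckeValue L μ (((fun _ => 1, Pi.mulSingle w z) : mixedEmbedding.mixedSpace L))) z₀ :=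
  Literature.Analysis.SpecialFunctions.differentiableAt_of_map_mul_complex (fun _ _ hz hz' => archHeckeValue_single_mul L μ w hz hz')
    (fun _ hz => continuousAt_archHeckeValue_single L μ w hz) (fun _ hz => archHeckeValue_single_ne_zero L μ w hz) hz₀

end Single

/-! ## §2 Along the singular curve: `hμ` discharged, `τ_∞` and `Δ″_∞` differentiable at `ψ = 0` -/

section Curve

variable (L : Type) [Field L] [NumberField L] [IsCMField L] (α : Fin 3 → L)
  (z₀ : {w : InfinitePlace L // IsComplex w} → Fin 3 → Circle) (c : {w : InfinitePlace L // IsComplex w} → ℝ)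
  (γH : ℝ →
    ↥(UnitaryGroup.arch (↥(maximalRealSubfield L)) L (IsCMField.complexConj L) 2
        (Matrix.of fun i j : Fin 2 => if i.val + j.val + 1 = 2 then (1 : L) else 0)) ×
      ↥(UnitaryGroup.arch (↥(maximalRealSubfield L)) L (IsCMField.complexConj L) 1
        (Matrix.of fun i j : Fin 1 => if i.val + j.val + 1 = 1 then (1 : L) else 0)))
  (γG : ℝ → ↥(UnitaryGroup.arch (↥(maximalRealSubfield L)) L (IsCMField.complexConj L) 3 (Matrix.diagonal α)))
  (hγH : γH = fun ψ =>
    ((UnitaryGroup.archPiEquivCM 2 L (Matrix.of fun i j : Fin 2 => if i.val + j.val + 1 = 2 then (1 : L) else 0)).symm fun w =>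
        ⟨Matrix.GeneralLinearGroup.mkOfDetNeZero !![(1 : ℂ), 1; 1, -1] UnitaryGroup.det_cayleyTwo_ne_zero *
            UnitaryGroup.circleDiagonal 2 ![z₀ w 0 * Circle.exp (![(1 : ℝ), 0, -1] 0 * (c w * ψ)), z₀ w 2 * Circle.exp (![(1 : ℝ), 0, -1] 2 * (c w * ψ))] *
          (Matrix.GeneralLinearGroup.mkOfDetNeZero !![(1 : ℂ), 1; 1, -1] UnitaryGroup.det_cayleyTwo_ne_zero)⁻¹,
          UnitaryGroup.cayley_conj_circleDiagonal_mem_archLocal L w _⟩,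
      (UnitaryGroup.archPiEquivCM 1 L (Matrix.of fun i j : Fin 1 => if i.val + j.val + 1 = 1 then (1 : L) else 0)).symm fun w =>
        ⟨UnitaryGroup.circleDiagonal 1 ![z₀ w 1 * Circle.exp (![(1 : ℝ), 0, -1] 1 * (c w * ψ))],
          UnitaryGroup.circleDiagonal_mem_archLocal_antidiagOne L w _⟩))
  (hγG : γG = fun ψ => UnitaryGroup.archDiagTorus L 3 α fun w i => z₀ w i * Circle.exp (![(1 : ℝ), 0, -1] i * (c w * ψ)))
  (h02 : ∀ w, z₀ w 0 = z₀ w 2) (h01 : ∀ w, z₀ w 0 ≠ z₀ w 1)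
  (μ : HeckeCharacter L) (hherm : ((Matrix.diagonal α).map (cmConjRingHom L)).transpose = Matrix.diagonal α)
  (hanis : ∀ x : Fin 3 → L, Literature.AlgebraicGeometry.ShimuraVarieties.hermForm (cmConjRingHom L) (Matrix.diagonal α) x x = 0 → x = 0)

include hγH h02 h01 in
open scoped Classical in
/-- **`hμ` DISCHARGED**: `ψ ↦ μ_∞(t(ψ))` is differentiable at `0` along the lifted singular curve — `μ_∞(t(ψ)) = Π_w F_w(σ_w t(ψ))` near `0` (§1 place factorisation;
`t(ψ)` is a unit near `0`), each `σ_w t(ψ)` differentiable in `ψ` (★ `differentiableAt_evalC_archTauArg_archSingularCurveH`) and each `F_w` differentiable at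
`σ_w t(0) ≠ 0` (§1, ★ §A). [cite: Rogawski1990, §8.2 (8.2.1) p. 123] -/
theorem differentiableAt_archHeckeValue_archTauArg_archSingularCurve :
    DifferentiableAt ℝ (fun ψ => archHeckeValue L μ (archTauArg L (γH ψ))) 0 := by
  have hu0 : IsUnit (archTauArg L (γH 0)) :=
    isUnit_archTauArg_of_isUnit L (γH 0) (isUnit_eval_archCharpolyTwo_archSingularCurveH_zero L z₀ c γH hγH h02 h01)
  -- `t(ψ)` is a unit near `0` (continuity of the curve + openness of the units)
  have hcont : ContinuousAt (fun ψ => archTauArg L (γH ψ)) 0 :=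
    ContinuousAt.comp (f := fun ψ => (γH ψ)) (g := fun a => archTauArg L a) (continuous_archTauArg L).continuousAt
      (continuous_archSingularCurveH L z₀ c γH hγH).continuousAt
  have hunit : ∀ᶠ ψ in 𝓝 (0 : ℝ), IsUnit (archTauArg L (γH ψ)) := hcont.eventually ((isOpen_setOf_isUnit_mixedSpace L).mem_nhds hu0)
  have hEq : (fun ψ => archHeckeValue L μ (archTauArg L (γH ψ))) =ᶠ[𝓝 (0 : ℝ)]
      fun ψ => ∏ w : {w : InfinitePlace L // IsComplex w},
        archHeckeValue L μ (((fun _ => 1, Pi.mulSingle w (UnitaryGroup.evalC L w (archTauArg L (γH ψ)))) : mixedEmbedding.mixedSpace L)) := by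
    filter_upwards [hunit] with ψ hψ
    rw [archHeckeValue_eq_prod_single L μ hψ]
    rfl
  refine (hEq.differentiableAt_iff).2 ?_
  have hne : ∀ w : {w : InfinitePlace L // IsComplex w}, UnitaryGroup.evalC L w (archTauArg L (γH 0)) ≠ 0 := fun w =>
    (hu0.map (UnitaryGroup.evalC L w)).ne_zero
  have hf : ∀ w ∈ (Finset.univ : Finset {w : InfinitePlace L // IsComplex w}),
      HasDerivAt (fun ψ : ℝ => archHeckeValue L μ (((fun _ => 1, Pi.mulSingle w (UnitaryGroup.evalC L w (archTauArg L (γH ψ)))) : mixedEmbedding.mixedSpace L)))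
        (deriv (fun ψ : ℝ => archHeckeValue L μ
          (((fun _ => 1, Pi.mulSingle w (UnitaryGroup.evalC L w (archTauArg L (γH ψ)))) : mixedEmbedding.mixedSpace L))) 0) 0 := by
    intro w _
    refine DifferentiableAt.hasDerivAt ?_
    exact DifferentiableAt.comp (𝕜 := ℝ) (E := ℝ) (F := ℂ) (G := ℂ) (0 : ℝ)
      (g := fun z : ℂ => archHeckeValue L μ (((fun _ => 1, Pi.mulSingle w z) : mixedEmbedding.mixedSpace L)))
      (differentiableAt_archHeckeValue_single L μ w (hne w))
      (differentiableAt_evalC_archTauArg_archSingularCurveH L z₀ c γH hγH w 0)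
  exact (HasDerivAt.fun_finsetProd hf).differentiableAt

include hγH h02 h01 in
/-- **`ψ ↦ τ_∞(γ_H(ψ))` is differentiable at `ψ = 0`** along the lifted singular curve (★ `differentiableAt_archTau_archSingularCurve_of` with `hμ` discharged).
[cite: Rogawski1990, §8.2 (8.2.1) p. 123; §4.9 p. 55] -/
theorem differentiableAt_archTau_archSingularCurve : DifferentiableAt ℝ (fun ψ => archTau L (γH ψ) μ) 0 :=
  differentiableAt_archTau_archSingularCurve_of L z₀ c γH hγH h02 h01 μ
    (differentiableAt_archHeckeValue_archTauArg_archSingularCurve L z₀ c γH hγH h02 h01 μ)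

include hγH hγG h02 h01 hherm hanis in
open scoped Classical in
/-- **`ψ ↦ Δ″_∞(γ_H(ψ), γ(ψ))` IS DIFFERENTIABLE AT `ψ = 0`** along the lifted singular curve — UNCONDITIONALLY (★ `differentiableAt_archExplicitDelta_archSingularCurve_of`
with its binder `hμ` discharged): the transfer-factor half of print's `∂∕∂ψ (τ(γ)D_G(γ)Φ^κ(γ,f))|_{ψ=0}`. [cite: Rogawski1990, §8.2 (8.2.1) p. 123; §14.6 p. 242] -/
theorem differentiableAt_archExplicitDelta_archSingularCurve :
    DifferentiableAt ℝ (fun ψ => archExplicitDelta L (Matrix.diagonal α) (γH ψ) μ (γG ψ)) 0 :=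
  differentiableAt_archExplicitDelta_archSingularCurve_of L α z₀ c γH γG hγH hγG h02 h01 μ hherm hanis
    (differentiableAt_archHeckeValue_archTauArg_archSingularCurve L z₀ c γH hγH h02 h01 μ)

end Curve

end Literature.NumberTheory.Rogawski1990

end
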